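/-
Copyright (c) 2026. All rights reserved.
Released under Apache 2.0 license as described in the file LICENSE.
-/
import Summits.CriticalPhenomena.LaceExpansionHighD.NobleBoundsNMidSCornerMid
import HarnessLib

/-!
# Fitzner–van der Hofstad (2017), Prop. 5.5 (5.34) at `N = M + 2` against the SHARP blocks, hypothesis-free — Part I
§F: the corner (`R′`) cell packages of a MIDDLE junction over a CLOSED lower level (the lower-`★` pair; bodies =
`NobleBoundsNLowStar` verbatim except for the exit letter) (WHAT-IF, DIVERGENCE D77; b2b-lace LEMMAS node
N76-X2-D77, module 4/11)

[FvdH17] = R. Fitzner, R. van der Hofstad, *Mean-field behavior for nearest-neighbor percolation in `d > 10`*,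
arXiv:1506.07977v2 (EJP 22 (2017), paper 43).  Page numbers refer to the arXiv version.

SPLIT PROVENANCE: module 4 of 11 of the b2b-lace node N76-X2-D77 (what-if, DIVERGENCE D77) — the 11 modules are the
section-seam split (carver-g217, 2026-08-27) of the single-module form `NobleBoundsNSharpD77.lean` (carver-g51
text-final, sha256 `877e12977f9f9c92`, 2707 lines): every declaration, statement and proof is carried over verbatim and
in the original order; only module boundaries, the repeated `section`/`variable` headers and two docstrings were added.
PLACEMENT: what-if objects of `NobleBlocksSharp` (b2b-lace LEAN PLACEMENT RULE, REFEREE R491), hence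
`namespace Summit.CriticalPhenomena.LaceExpansionHighD.NobleBlocks`.  Conventions: `d`-generic; every declaration
carries its [FvdH17] display / page cite in the docstring; NOTHING is cited as a fact (b2b-lace ABSOLUTE RULE);
additive (no existing declaration is changed). -/

noncomputable section

namespace Summit.CriticalPhenomena.LaceExpansionHighD.NobleBlocks

open Literature.Probability.FitznerVanDerHofstad2017 Literature.Probability.FitznerVanDerHofstad2017.NobleBlocks
open Literature.Probability.FitznerVanDerHofstad2017.NobleBlocks.LenIdx
open Literature.Probability.LatticeModels Literature.Probability.Percolation
open Literature.Probability.FitznerVanDerHofstad2017.BlockSummation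
open Literature.Barriers.CriticalPhenomena
open Literature.Combinatorics.SimpleGraph _root_.SimpleGraph _root_.MeasureTheory
open scoped BigOperators ENNReal Matrix

variable {d : ℕ}

/-! ### F. The MIDDLE junction on the corner over a CLOSED lower level (the lower-`★` pair, residue `R′`) -/

section LowPackages

variable (p : unitInterval) (M : ℕ) (x : Site d) (b : Fin (M + 2) → Site d × Site d) (w t z : Fin (M + 2) → Site d)
  (a : Fin (M + 2) → Fin 3 ⊕ Unit) (c : Fin 3 ⊕ Unit) (τ : Fin (M + 1) → Bool × Fin 3)

/-- The PARAMETER FACTS of a non-empty `F‴` piece on the corner that do not involve the lower class: `t ≠ u′`,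
`w′ ≠ u′` for `a′ ≠ 0`, `t = z` in inner class `0`, `t ∼ z` in inner class `1`.
[cite: FitznerVanDerHofstad2017, §4.4 (4.61), (4.62), (4.64) (arXiv:1506.07977v2 pp. 41–42)] -/
theorem cornerS_facts {ω : Fin (M + 3) → BondConfig (Site d)} {K₀ : Fin (M + 3) → Fin 6 → Set (Sym2 (Site d))}
    (hF : JFacts M x b w t z a c τ ω K₀) (i : Fin (M + 1)) (hσ : (τ i).1 = false) {a' : Fin 3}
    (ha' : a i.succ = Sum.inl a') :
    t i.castSucc ≠ (b i.succ).1 ∧ (a' ≠ 0 → w i.succ ≠ (b i.succ).1) ∧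
      ((τ i).2 = 0 → t i.castSucc = z i.castSucc) ∧ ((τ i).2 = 1 → (zdGraph d).Adj (t i.castSucc) (z i.castSucc)) :=
  ⟨(hF.canon_midS i hσ ha').2, fun h0 => (hF.u_ne_w_of_exitClass_ne_zero i.succ ha' h0).symm,
    hF.t_eq_z_of_innerClass_zero i, fun h1 => (hF.innerClass_one i h1).2.2⟩

/-- **Cells `(★, 0, a′)`, `a′ ∈ {1,2}`, variant `F‴`, over a CLOSED lower level, ON THE CORNER `w′ = t`, on the pin
`z_k = w_k`**: a package with target `A'^{κ,2,0,*}(u_k,w_k,t_k,z_k) · A♯^{0,a′}(t_k,z_k,w_{k+1},u_{k+1})` — row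
`a = 2` of `nonempty_jPkg_midS_zero_corner'` with the exit line of level `k` replaced by the trivially witnessed
`{z_k ↔ w_k}` (a closed lower level owns no active slot).
[cite: FitznerVanDerHofstad2017, §6.1 (6.4), "Case a ≥ 2", "Case b = 1, ≥ 2" (arXiv:1506.07977v2 pp. 58–59); §5.1 (5.4) (p. 48) and "Elements of the bounds" (p. 49); App. B (pp. 74–75); §4.4 (4.61), (4.62), (4.64), text after (4.66) (pp. 41–42)] -/
theorem nonempty_jPkg_lowS_zero_corner' (i i₀ : Fin (M + 1)) (hk : i₀.succ = i.castSucc) (κ : Fin d × Bool)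
    (hb : (b i.castSucc).2 = (b i.castSucc).1 + stepVec κ) (hσ : (τ i).1 = false) (hc0 : (τ i).2 = 0)
    {u₀ : Unit} (ha : a i.castSucc = Sum.inr u₀) {a' : Fin 3} (ha' : a i.succ = Sum.inl a') (ha'0 : a' ≠ 0)
    (hwt : w i.succ = t i.castSucc) (hzw : z i.castSucc = w i.castSucc) :
    Nonempty (JPkg p (jctx M x b w t z a τ i.castSucc) (JFacts M x b w t z a c τ)
      (blockAiotaSt' (Letters.perc d p) κ 2 0 (b i.castSucc).1 (w i.castSucc) (t i.castSucc) (z i.castSucc) *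
        blockASharp (Letters.perc d p) 0 a' (t i.castSucc) (z i.castSucc) (w i.succ) (b i.succ).1)) := by
  rw [blockAiotaSt'_of_ne _ _ (fun h => absurd h.1 (by decide))]
  -- degenerate parameters: the piece is empty
  by_cases hP : (t i.castSucc ≠ (b i.succ).1 ∧ (a' ≠ 0 → w i.succ ≠ (b i.succ).1) ∧
      ((τ i).2 = 0 → t i.castSucc = z i.castSucc) ∧ ((τ i).2 = 1 → (zdGraph d).Adj (t i.castSucc) (z i.castSucc))) ∧
      (b i.castSucc).2 ≠ z i.castSucc
  swap
  · exact ⟨JPkg.vacuous p _ _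
      (fun ω K₀ hF => hP ⟨cornerS_facts M x b w t z a c τ hF i hσ ha', hF.v_ne_z_of_closedL i i₀ hk ha⟩) _⟩
  obtain ⟨hQ, hvz⟩ := hP
  have htz : t i.castSucc = z i.castSucc := hQ.2.2.1 hc0
  obtain ⟨E3, E4, f3, f4, hmem₂, hrow₂⟩ :=
    midS_cornerLetter_piPerc p M x b w t z a c τ i hσ ha' ha'0 0 hwt hQ hc0
  refine nonempty_jPkg_midSLow_core p M x b w t z a c τ i i₀ hk κ hb hσ ha ha'
    (event (ge 1) (b i.castSucc).2 (t i.castSucc)) Set.univ Set.univ E3 E4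
    (isFinitary_event _ _ _) isFinitary_univ isFinitary_univ f3 f4
    (fun ω K₀ hF => ⟨?_, Set.mem_univ _, Set.mem_univ _, (hmem₂ ω K₀ hF).1, (hmem₂ ω K₀ hF).2⟩) ?_
    ((junF_midSCorner_up_le₂ p M x b w t z a τ i hσ ha' _ _ _ _ _ _ _).trans hrow₂)
  · obtain ⟨h0, -⟩ := hF.conn_midS i hσ ha'
    rw [event_ge]; exact mem_openConnGe_one_of_ne h0 (by rw [htz]; exact hvz)
  · -- `A^{κ,2,0,*}`: bond, `v → t` (+ the trivially witnessed `z ↔ w`)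
    refine (junF_midSLow_xb_le₂ p M x b w t z a τ i hσ ha' _ _ _ _ _ _ _).trans ?_
    refine (measure_mono (genDisjOcc_pair_subset_triple _ _ (event (ge 0) (t i.castSucc) (w i.castSucc))
      (by rw [htz, hzw]; exact empty_mem_event_ge_zero_self (w i.castSucc)) 0 1 0)).trans ?_
    rw [← htz]
    exact piPerc_midS_two_zero_le_blockAiotaSt p hb ![0, 1, 0]

/-- **Cells `(★, 1, a′)`, `a′ ∈ {1,2}`, variant `F‴`, over a CLOSED lower level, ON THE CORNER `w′ = t`, on the pin
`z_k = w_k`**: target `A^{κ,2,1,*}(u_k,w_k,t_k,z_k) · A♯^{1,a′}(t_k,z_k,w_{k+1},u_{k+1})` (the sausage line is the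
open bond `{t ←1̲→ z}` itself).
[cite: FitznerVanDerHofstad2017, §6.1 (6.4), "Case a ≥ 2", "Case b = 1, ≥ 2" (arXiv:1506.07977v2 pp. 58–59); §5.1 (5.4) (p. 48) and "Elements of the bounds" (p. 49); App. B (pp. 74–75); §4.4 (4.61), (4.62), (4.64), text after (4.66) (pp. 41–42)] -/
theorem nonempty_jPkg_lowS_one_corner (i i₀ : Fin (M + 1)) (hk : i₀.succ = i.castSucc) (κ : Fin d × Bool)
    (hb : (b i.castSucc).2 = (b i.castSucc).1 + stepVec κ) (hσ : (τ i).1 = false) (hc1 : (τ i).2 = 1)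
    {u₀ : Unit} (ha : a i.castSucc = Sum.inr u₀) {a' : Fin 3} (ha' : a i.succ = Sum.inl a') (ha'0 : a' ≠ 0)
    (hwt : w i.succ = t i.castSucc) (hzw : z i.castSucc = w i.castSucc) :
    Nonempty (JPkg p (jctx M x b w t z a τ i.castSucc) (JFacts M x b w t z a c τ)
      (blockAiotaSt (Letters.perc d p) κ 2 1 (b i.castSucc).1 (w i.castSucc) (t i.castSucc) (z i.castSucc) *
        blockASharp (Letters.perc d p) 1 a' (t i.castSucc) (z i.castSucc) (w i.succ) (b i.succ).1)) := by
  -- degenerate parameters: the piece is empty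
  by_cases hP : (t i.castSucc ≠ (b i.succ).1 ∧ (a' ≠ 0 → w i.succ ≠ (b i.succ).1) ∧
      ((τ i).2 = 0 → t i.castSucc = z i.castSucc) ∧ ((τ i).2 = 1 → (zdGraph d).Adj (t i.castSucc) (z i.castSucc))) ∧
      t i.castSucc ≠ z i.castSucc
  swap
  · exact ⟨JPkg.vacuous p _ _ (fun ω K₀ hF => hP ⟨cornerS_facts M x b w t z a c τ hF i hσ ha',
      hF.t_ne_z_of_innerClass_ne_zero i (by rw [hc1]; decide)⟩) _⟩
  obtain ⟨hQ, htz⟩ := hP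
  obtain ⟨E3, E4, f3, f4, hmem₂, hrow₂⟩ :=
    midS_cornerLetter_piPerc p M x b w t z a c τ i hσ ha' ha'0 1 hwt hQ hc1
  -- the open sausage bond is its own witness
  have hbond : ∀ ω K₀, JFacts M x b w t z a c τ ω K₀ →
      K₀ i.castSucc.succ 1 ∈ (event (eq 1) (t i.castSucc) (z i.castSucc) : Set (BondConfig (Site d))) := by
    intro ω K₀ hF
    rw [hF.tz_witness_midS i hσ ha' htz (hF.innerClass_one i hc1).2.1]
    exact singleton_mem_event_eq_one htz
  refine nonempty_jPkg_midSLow_core p M x b w t z a c τ i i₀ hk κ hb hσ ha ha'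
    (event (ge 0) (b i.castSucc).2 (t i.castSucc)) (event (eq 1) (t i.castSucc) (z i.castSucc)) Set.univ E3 E4
    (isFinitary_event _ _ _) (isFinitary_event _ _ _) isFinitary_univ f3 f4
    (fun ω K₀ hF => ⟨?_, hbond ω K₀ hF, Set.mem_univ _, (hmem₂ ω K₀ hF).1, (hmem₂ ω K₀ hF).2⟩) ?_
    ((junF_midSCorner_up_le₂ p M x b w t z a τ i hσ ha' _ _ _ _ _ _ _).trans hrow₂)
  · obtain ⟨h0, -⟩ := hF.conn_midS i hσ ha'
    rw [event_ge]; exact mem_openConnGe_zero_of_mem h0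
  · -- `A^{κ,2,1,*}`: bond, `v → t`, the open bond `t — z` (+ the trivially witnessed `z ↔ w`)
    refine (junF_midSLow_xb_le₃ p M x b w t z a τ i hσ ha' _ _ _ _ _ _ _).trans ?_
    refine (measure_mono (genDisjOcc_triple_subset_quad _ _ _ (event (ge 0) (z i.castSucc) (w i.castSucc))
      (by rw [hzw]; exact empty_mem_event_ge_zero_self (w i.castSucc)) 0 1 1 0)).trans ?_
    exact piPerc_midS_two_one_le_blockAiotaSt p hb ![0, 1, 1, 0]

/-- **Cells `(★, 2, a′)`, `a′ ∈ {1,2}`, variant `F‴`, over a CLOSED lower level, ON THE CORNER `w′ = t`, on the pin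
`z_k = w_k`**: target `A^{κ,2,2,*}(u_k,w_k,t_k,z_k) · A♯^{2,a′}(t_k,z_k,w_{k+1},u_{k+1})`.
[cite: FitznerVanDerHofstad2017, §6.1 (6.4), "Case a ≥ 2", "Case b = 1, ≥ 2" (arXiv:1506.07977v2 pp. 58–59); §5.1 (5.4) (p. 48) and "Elements of the bounds" (p. 49); App. B (pp. 74–75); §4.4 (4.61), (4.62), (4.64), text after (4.66) (pp. 41–42)] -/
theorem nonempty_jPkg_lowS_two_corner (i i₀ : Fin (M + 1)) (hk : i₀.succ = i.castSucc) (κ : Fin d × Bool)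
    (hb : (b i.castSucc).2 = (b i.castSucc).1 + stepVec κ) (hσ : (τ i).1 = false) (hc2 : (τ i).2 = 2)
    {u₀ : Unit} (ha : a i.castSucc = Sum.inr u₀) {a' : Fin 3} (ha' : a i.succ = Sum.inl a') (ha'0 : a' ≠ 0)
    (hwt : w i.succ = t i.castSucc) (hzw : z i.castSucc = w i.castSucc) :
    Nonempty (JPkg p (jctx M x b w t z a τ i.castSucc) (JFacts M x b w t z a c τ)
      (blockAiotaSt (Letters.perc d p) κ 2 2 (b i.castSucc).1 (w i.castSucc) (t i.castSucc) (z i.castSucc) *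
        blockASharp (Letters.perc d p) 2 a' (t i.castSucc) (z i.castSucc) (w i.succ) (b i.succ).1)) := by
  -- degenerate parameters: the piece is empty
  by_cases hP : (t i.castSucc ≠ (b i.succ).1 ∧ (a' ≠ 0 → w i.succ ≠ (b i.succ).1) ∧
      ((τ i).2 = 0 → t i.castSucc = z i.castSucc) ∧ ((τ i).2 = 1 → (zdGraph d).Adj (t i.castSucc) (z i.castSucc))) ∧
      t i.castSucc ≠ z i.castSucc
  swap
  · exact ⟨JPkg.vacuous p _ _ (fun ω K₀ hF => hP ⟨cornerS_facts M x b w t z a c τ hF i hσ ha',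
      hF.t_ne_z_of_innerClass_ne_zero i (by rw [hc2]; decide)⟩) _⟩
  obtain ⟨hQ, htz⟩ := hP
  obtain ⟨E3, E4, f3, f4, hmem₂, hrow₂⟩ :=
    midS_cornerLetter_piPerc p M x b w t z a c τ i hσ ha' ha'0 2 hwt hQ hc2
  refine nonempty_jPkg_midSLow_core p M x b w t z a c τ i i₀ hk κ hb hσ ha ha'
    (event (ge 0) (b i.castSucc).2 (t i.castSucc)) (event (ge 2) (t i.castSucc) (z i.castSucc)) Set.univ E3 E4
    (isFinitary_event _ _ _) (isFinitary_event _ _ _) isFinitary_univ f3 f4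
    (fun ω K₀ hF => ⟨?_, ?_, Set.mem_univ _, (hmem₂ ω K₀ hF).1, (hmem₂ ω K₀ hF).2⟩) ?_
    ((junF_midSCorner_up_le₂ p M x b w t z a τ i hσ ha' _ _ _ _ _ _ _).trans hrow₂)
  · obtain ⟨h0, -⟩ := hF.conn_midS i hσ ha'
    rw [event_ge]; exact mem_openConnGe_zero_of_mem h0
  · obtain ⟨-, h1, -⟩ := hF.conn_midS i hσ ha'
    rw [event_ge]
    exact mem_openConnGe_two_of_notMem h1 htz fun hm => (hF.innerClass_two i hc2).2 (hF.witness_subset _ 1 hm)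
  · -- `A^{κ,2,2,*}`: bond, `v → t`, `t ⇐2⇒ z` (+ the trivially witnessed `z ↔ w`)
    refine (junF_midSLow_xb_le₃ p M x b w t z a τ i hσ ha' _ _ _ _ _ _ _).trans ?_
    refine (measure_mono (genDisjOcc_triple_subset_quad _ _ _ (event (ge 0) (z i.castSucc) (w i.castSucc))
      (by rw [hzw]; exact empty_mem_event_ge_zero_self (w i.castSucc)) 0 1 1 0)).trans ?_
    exact piPerc_midS_two_two_le_blockAiotaSt p hb ![0, 1, 1, 0]

/-- **THE CORNER CELL OF A MIDDLE LOWER-`★` PAIR** — the slot `hR′` of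
`NobleBoundsNLowE.nonempty_jPkg_mid_starL'` (kind `false`, `a′ ≠ 0`, `w_{k+1} = t_k`) on the pin `z_k = w_k`,
DISCHARGED against the Sharp payload: a package with target the `R′`-slice at lower class `2`,
`blockXRPrime L (τ i).2 κ 2 a′ = A'^{κ,2,c,*}(u_k,w_k,t_k,z_k) · A♯^{c,a′}(t_k,z_k,w_{k+1},u_{k+1})` for every
inner class `c = (τ i).2` (b2b-lace LEMMAS node N76-X2-D77, leaf T2c).  Off the pin the piece is empty
(`NobleBoundsNDispatchStarL.nonempty_jPkg_of_closedL_of_ne`).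
[cite: FitznerVanDerHofstad2017, §6.1 (6.4), "Case a ≥ 2", "Case b = 1, ≥ 2" (arXiv:1506.07977v2 pp. 58–59); §5.1 (5.4) (p. 48) and "Elements of the bounds" (p. 49); App. B (pp. 74–75); §4.4 (4.61), (4.62), (4.64), text after (4.66) (pp. 41–42)] -/
theorem nonempty_jPkg_lowS_corner (i i₀ : Fin (M + 1)) (hk : i₀.succ = i.castSucc) (κ : Fin d × Bool)
    (hb : (b i.castSucc).2 = (b i.castSucc).1 + stepVec κ) {u₀ : Unit} (a' : Fin 3)
    (ha : a i.castSucc = Sum.inr u₀) (ha' : a i.succ = Sum.inl a') (hσ : (τ i).1 = false) (ha'0 : a' ≠ 0)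
    (hwt : w i.succ = t i.castSucc) (hzw : z i.castSucc = w i.castSucc) :
    Nonempty (JPkg p (jctx M x b w t z a τ i.castSucc) (JFacts M x b w t z a c τ)
      (blockXRPrime (Letters.perc d p) (τ i).2 κ 2 a' (b i.castSucc).1 (w i.castSucc) (t i.castSucc) (z i.castSucc)
        (w i.succ) (b i.succ).1)) := by
  unfold blockXRPrime
  have h3 : ∀ e : Fin 3, e = 0 ∨ e = 1 ∨ e = 2 := by decide
  rcases h3 (τ i).2 with hc | hc | hc <;> rw [hc]
  · exact nonempty_jPkg_lowS_zero_corner' p M x b w t z a c τ i i₀ hk κ hb hσ hc ha ha' ha'0 hwt hzw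
  · rw [blockAiotaSt'_of_ne _ _ (fun h => absurd h.2 (by decide))]
    exact nonempty_jPkg_lowS_one_corner p M x b w t z a c τ i i₀ hk κ hb hσ hc ha ha' ha'0 hwt hzw
  · rw [blockAiotaSt'_of_ne _ _ (fun h => absurd h.2 (by decide))]
    exact nonempty_jPkg_lowS_two_corner p M x b w t z a c τ i i₀ hk κ hb hσ hc ha ha' ha'0 hwt hzw

end LowPackages

end Summit.CriticalPhenomena.LaceExpansionHighD.NobleBlocks

end
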